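import Literature.IUT.HodgeTheaters.CoveringsErrata
import HarnessLib

/-!
# [IUTchI] Remark 1.2.3 (vi): the universal closure of the typed cuspidality reduction is FALSE (proof-only)

Mochizuki, *Inter-universal Teichmüller theory I*, kurims manuscript (May 2020), Remark 1.2.3 (vi),
p. 43 [cite: Mochizuki2012, IUTchI Rmk 1.2.3 (vi) p.43] — the replacement text of the second paragraph
of the proof of [CombGC] Theorem 1.6 (i): "the fact that `α` is group-theoretically cuspidal follows
formally from the characterization of cuspidal edge-like subgroups given in Remark 1.4.3 and the
characterization of cuspidally totally ramified cyclic finite étale coverings given in Remark 1.4.2".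
`CoveringsErrata.lean` (abc-iut-L5-t6) types this sentence as the SCHEMA
`Rmk123.GroupTheoreticCuspidalityReduction Ω` over the blackbox origin parameter `Ω : PSCOrigin`
("of pro-Σ PSC-type", [CombGC] Def. 1.1 (i), never constructed); the abc-iut FACT-LIST carries it as
the parametrised row **F-1978**.

This PROOF-ONLY file records, per the cell's rule for parametrised rows (plan R1 (ii) / R5), that the
UNIVERSAL CLOSURE `∀ Ω, GroupTheoreticCuspidalityReduction Ω` is FALSE
(`Rmk123.not_forall_groupTheoreticCuspidalityReduction`): at the all-inclusive origin
(`IsOfPSCType := True`) the typed implication fails for explicit NON-COMPACT data — the discrete group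
`Multiplicative ℚ` (divisible, hence pro-`{2}` vacuously and without open subgroups of index `2 ^ k`,
`k > 0`), one vertex, one cusp, cuspidal subgroup `ℤ · 1` on one side and `ℤ · 2` on the other,
`α = id`.  Both amended characterizations ([IUTchI] Rmk. 1.2.3 (iv), cuspidal half) hold (over a
discrete abelian group `cond(A)` tested at the characteristic open subgroup `U = 1` forces `A ⊆ Π_c`),
both cyclic criteria (Rmk. 1.2.3 (iii)) hold vacuously, `α` is numerically cuspidal (every double-coset
count `U \ ℚ / Π_c` is `[ℚ : U + Π_c] ∈ {0, 1}`, and `U + ℤ = ℚ ⟺ U + 2ℤ = ℚ`), yet `α` is not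
group-theoretically cuspidal (`ℤ ≠ 2ℤ`).  The interface `PSCDatum` does not record that `Π_G` is
profinite; compactness is exactly what the kernel proof of the row uses ("characteristic open ⟹ finite
index"): the INSTANCE FORM at every origin whose data have compact `Π` is already kernel-checked
(`Rmk123.groupTheoreticCuspidalityReduction_of_compactOrigin`, `CoveringsErrataCuspidalProofs.lean`,
from abc-iut-w4-d052's `PSCDatum.isGroupTheoreticallyCuspidal_of_isNumericallyCuspidal`).  So the row
is a SCHEMA, consumable origin-relatively (compact origins), never as a closed fact.

Refuting a universal closure at junk data asserts nothing about curves or about the printed claim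
(whose `Π_G` is profinite); no side is taken on [IUTchIII] Cor. 3.12; typed ≠ proved.
-/

noncomputable section

namespace Literature.IUT.HodgeTheaters.Rmk123

open Literature.AnabelianGeometry.SemiGraphs
open scoped Pointwise

/-! ### Elementary lemmas: double cosets and finite-index subgroups of a divisible commutative group -/

/-- In a commutative group the double-coset space `U \ P / S` is the coset space `P / (U · S)`, so its
`Nat.card` is the index `[P : U · S]`. [folklore] -/
private theorem natCard_doubleCosetQuotient_eq_index {P : Type*} [CommGroup P] (U S : Subgroup P) :
    Nat.card (DoubleCoset.Quotient (U : Set P) (S : Set P)) = (U ⊔ S).index := by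
  rw [Subgroup.index]
  refine Nat.card_congr (Quotient.congrRight fun x y => ?_)
  rw [DoubleCoset.rel_iff, QuotientGroup.leftRel_apply, Subgroup.mem_sup]
  constructor
  · rintro ⟨a, ha, b, hb, rfl⟩
    exact ⟨a, ha, b, hb, by rw [mul_comm a x, mul_assoc, inv_mul_cancel_left]⟩
  · rintro ⟨a, ha, b, hb, hab⟩
    refine ⟨a, ha, b, hb, ?_⟩
    rw [mul_comm a x, mul_assoc, hab, mul_inv_cancel_left]

/-- A subgroup of finite index in a divisible commutative group is the whole group
(`g ^ [P : V] ∈ V`). [folklore] -/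
private theorem eq_top_of_index_ne_zero {P : Type*} [CommGroup P]
    (hdiv : ∀ n : ℕ, 0 < n → ∀ x : P, ∃ y : P, y ^ n = x) {V : Subgroup P} (hV : V.index ≠ 0) :
    V = ⊤ := by
  rw [eq_top_iff]
  intro x _
  obtain ⟨y, rfl⟩ := hdiv V.index (Nat.pos_of_ne_zero hV) x
  exact V.pow_index_mem y

/-- Hence the index of a subgroup of a divisible commutative group only records whether the
subgroup is everything: subgroups that are simultaneously `⊤` have the same index. [folklore] -/
private theorem index_eq_index_of_iff {P : Type*} [CommGroup P]
    (hdiv : ∀ n : ℕ, 0 < n → ∀ x : P, ∃ y : P, y ^ n = x) {V W : Subgroup P}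
    (h : V = ⊤ ↔ W = ⊤) : V.index = W.index := by
  by_cases hV : V.index = 0
  · by_cases hW : W.index = 0
    · rw [hV, hW]
    · exfalso
      rw [h.mpr (eq_top_of_index_ne_zero hdiv hW), Subgroup.index_top] at hV
      exact one_ne_zero hV
  · have hVt := eq_top_of_index_ne_zero hdiv hV
    rw [hVt, h.mp hVt]

/-- A divisible commutative group is pro-`Σ` for every `Σ` (as typed: `IsProSigma` only constrains
FINITE quotients by open normal subgroups, and these are trivial). [folklore] -/
private theorem isProSigma_of_divisible {P : Type*} [CommGroup P] [TopologicalSpace P]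
    (hdiv : ∀ n : ℕ, 0 < n → ∀ x : P, ∃ y : P, y ^ n = x) (Sigma : Set ℕ) : IsProSigma Sigma P :=
  ⟨fun U hfin p hp hdvd => by
    haveI := hfin
    have hidx : (U.toOpenSubgroup : Subgroup P).index ≠ 0 := Subgroup.index_ne_zero_of_finite
    change p ∣ (U.toOpenSubgroup : Subgroup P).index at hdvd
    rw [eq_top_of_index_ne_zero hdiv hidx, Subgroup.index_top, Nat.dvd_one] at hdvd
    exact absurd hdvd hp.ne_one⟩

/-- `ℚ` is divisible: every element of `Multiplicative ℚ` is an `n`-th power for `n ≥ 1`. [folklore] -/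
private theorem rat_divisible (n : ℕ) (hn : 0 < n) (x : Multiplicative ℚ) :
    ∃ y : Multiplicative ℚ, y ^ n = x := by
  refine ⟨Multiplicative.ofAdd (x.toAdd / n), ?_⟩
  have h : (n : ℚ) * (x.toAdd / n) = x.toAdd := by
    have : (n : ℚ) ≠ 0 := by exact_mod_cast hn.ne'
    field_simp
  rw [← ofAdd_nsmul, nsmul_eq_mul, h]
  rfl

/-! ### The two junk data over the discrete group `Multiplicative ℚ` -/

/-- Over a DISCRETE commutative group, a datum all of whose (at least one) cusps carry one and the
same infinite cyclic cuspidal subgroup `S` satisfies the amended characterization of cuspidal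
subgroups, [IUTchI] Rmk. 1.2.3 (iv) (cuspidal half) AS TYPED: the fourth clause of `cond(A)` at the
characteristic open subgroup `U = 1` reads `A ⊆ Π_c = S`, and `cond(S)` holds, so the maximal
`cond`-subgroups are exactly the cuspidal ones, `{S}`. [cite: Mochizuki2012, IUTchI Rmk 1.2.3 (iv) pp.41-42] -/
private theorem cuspidalEdgeLikeCharacterization_of_discrete {P : Type} [CommGroup P]
    [TopologicalSpace P] [DiscreteTopology P] (D : PSCDatum P) (c₀ : D.graph.C)
    (S : Subgroup P) (hS : ∀ c, D.cuspGp c = S) (s : P) (hs : Subgroup.zpowers s = S)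
    (hSinf : (S : Set P).Infinite) : D.CuspidalEdgeLikeCharacterization := by
  intro l _
  dsimp only
  intro A
  -- conjugation is trivial in a commutative group
  have hsmul : ∀ (γ : ConjAct P) (B : Subgroup P), γ • B = B := fun γ B =>
    Subgroup.Normal.conjAct inferInstance γ
  have hcusp : ∀ B : Subgroup P, D.IsCuspidal B ↔ B = S := fun B => by
    constructor
    · rintro ⟨c, γ, rfl⟩
      rw [hsmul, hS]
    · intro hB
      exact ⟨c₀, 1, by rw [one_smul, hS, hB]⟩
  -- `cond(S)` holds
  have hcondS : IsClosed (S : Set P) ∧ (∃ a : P, (Subgroup.zpowers a).topologicalClosure = S) ∧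
      (S : Set P).Infinite ∧ ∀ U : Subgroup P, U.Characteristic → IsOpen (U : Set P) →
        D.IsCuspidallyTotallyRamified (S ⊔ U) U := by
    refine ⟨isClosed_discrete _, ⟨s, ?_⟩, hSinf, fun U _ hUo => ?_⟩
    · rw [hs]
      exact le_antisymm (S.topologicalClosure_minimal le_rfl (isClosed_discrete _))
        S.le_topologicalClosure
    · refine ⟨⟨le_sup_right, hUo, isOpen_discrete _, inferInstance⟩, c₀, 1, ?_⟩
      rw [hsmul, hS, inf_eq_right.mpr le_sup_left]
  -- `cond(B)` forces `B ≤ S`: test the fourth clause at the characteristic open subgroup `⊥`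
  have hle : ∀ B : Subgroup P, (IsClosed (B : Set P) ∧
      (∃ a : P, (Subgroup.zpowers a).topologicalClosure = B) ∧ (B : Set P).Infinite ∧
      ∀ U : Subgroup P, U.Characteristic → IsOpen (U : Set P) →
        D.IsCuspidallyTotallyRamified (B ⊔ U) U) → B ≤ S := by
    rintro B ⟨-, -, -, h4⟩
    obtain ⟨-, c, γ, hc⟩ := h4 ⊥ inferInstance (isOpen_discrete _)
    rw [hsmul, hS] at hc
    simp only [sup_bot_eq] at hc
    exact inf_eq_left.mp hc
  rw [hcusp]
  constructor
  · rintro rfl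
    exact ⟨hcondS, fun B hB hSB => le_antisymm hSB (hle B hB)⟩
  · rintro ⟨hA, hmax⟩
    exact hmax S hcondS (hle A hA)

/-- For a datum all of whose cusps carry the cuspidal subgroup `S` over a commutative group, the cusp
count of the covering `G_U` is `card C · [P : U · S]`. [cite: MochizukiCombGC2007, Def 1.1(ii) p.6] -/
private theorem cuspCount_eq_card_mul_index {P : Type} [CommGroup P] [TopologicalSpace P]
    (D : PSCDatum P) (S : Subgroup P) (hS : ∀ c, D.cuspGp c = S) (U : Subgroup P) :
    D.cuspCount U = Fintype.card D.graph.C * (U ⊔ S).index := by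
  unfold PSCDatum.cuspCount
  simp_rw [hS, natCard_doubleCosetQuotient_eq_index]
  rw [Finset.sum_const, Finset.card_univ, smul_eq_mul]

/-- Over a divisible commutative group the cyclic cuspidal criterion [IUTchI] Rmk. 1.2.3 (iii) AS
TYPED holds vacuously: no subgroup has index `l ^ k` with `k > 0`.
[cite: Mochizuki2012, IUTchI Rmk 1.2.3 (iii) p.41] -/
private theorem cyclicCuspidallyTotallyRamifiedIff_of_divisible {P : Type} [CommGroup P]
    [TopologicalSpace P] [IsTopologicalGroup P]
    (hdiv : ∀ n : ℕ, 0 < n → ∀ x : P, ∃ y : P, y ^ n = x) (D : PSCDatum P) :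
    D.CyclicCuspidallyTotallyRamifiedIff := by
  intro l k H' hl hk _ hidx
  exfalso
  have hlp : l.Prime := D.sigma_prime l (by rw [hl]; exact Set.mem_singleton l)
  have hne : H'.index ≠ 0 := by rw [hidx]; exact pow_ne_zero _ hlp.ne_zero
  rw [eq_top_of_index_ne_zero hdiv hne, Subgroup.index_top] at hidx
  exact (Nat.one_lt_pow hk.ne' hlp.one_lt).ne hidx

/-! ### F-1978 — the universal closure of `Rmk123.GroupTheoreticCuspidalityReduction` is false -/

/-- **F-1978 is a schema, not a fact**: the universal closure over the origin parameter of the typed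
[IUTchI] Remark 1.2.3 (vi) ("numerically cuspidal ⟹ group-theoretically cuspidal at `Σ = {l}`, granted
the amended characterizations Rmk. 1.2.3 (iii)/(iv) for `G` and `H`") FAILS at the all-inclusive
origin for NON-COMPACT data: over the discrete group `Multiplicative ℚ` (divisible), one vertex, one
cusp with cuspidal subgroup `ℤ · 1` for `G` and `ℤ · 2` for `H`, and `α = id`, all four hypotheses hold
and `α` is numerically cuspidal, but `α(ℤ · 1) = ℤ · 1` is not the cuspidal subgroup `ℤ · 2` of `H`.
(The printed claim concerns profinite `Π_G`; the compact-origin instance form is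
`groupTheoreticCuspidalityReduction_of_compactOrigin` — untouched.)
[cite: Mochizuki2012, IUTchI Rmk 1.2.3 (vi) p.43] -/
theorem not_forall_groupTheoreticCuspidalityReduction :
    ¬ ∀ Ω : PSCOrigin.{0}, GroupTheoreticCuspidalityReduction Ω := by
  intro h
  letI : TopologicalSpace (Multiplicative ℚ) := ⊥
  haveI : DiscreteTopology (Multiplicative ℚ) := ⟨rfl⟩
  -- the junk datum with cuspidal subgroup `T`: one vertex (`Π_v = Π`), no nodes, one cusp, `Σ = {2}`
  let mk : Subgroup (Multiplicative ℚ) → PSCDatum (Multiplicative ℚ) := fun T =>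
    { Sigma := {2}
      sigma_prime := fun p hp => by rw [Set.mem_singleton_iff.mp hp]; exact Nat.prime_two
      sigma_nonempty := ⟨2, rfl⟩
      graph := { V := Unit, N := Empty, C := Unit, nodeEnds := Empty.elim, cuspEnd := fun _ => () }
      vertGp := fun _ => ⊤, nodeGp := Empty.elim, cuspGp := fun _ => T, genus := fun _ => 2
      isClosed_vertGp := fun _ => isClosed_discrete _
      isClosed_nodeGp := fun e => e.elim, isClosed_cuspGp := fun _ => isClosed_discrete _
      nodeGp_le := fun e => e.elim, cuspGp_le := fun _ => ⟨1, le_top⟩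
      proSigma := isProSigma_of_divisible rat_divisible _ }
  obtain ⟨S₁, hS₁⟩ : ∃ S : Subgroup (Multiplicative ℚ),
      S = Subgroup.zpowers (Multiplicative.ofAdd (1 : ℚ)) := ⟨_, rfl⟩
  obtain ⟨S₂, hS₂⟩ : ∃ S : Subgroup (Multiplicative ℚ),
      S = Subgroup.zpowers (Multiplicative.ofAdd (2 : ℚ)) := ⟨_, rfl⟩
  -- conjugation is trivial; `α = id` acts trivially on subgroups
  have hsmul : ∀ (γ : ConjAct (Multiplicative ℚ)) (B : Subgroup (Multiplicative ℚ)), γ • B = B :=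
    fun γ B => Subgroup.Normal.conjAct inferInstance γ
  have hmap : ∀ T : Subgroup (Multiplicative ℚ),
      T.map (ContinuousMulEquiv.refl (Multiplicative ℚ)).toMulEquiv.toMonoidHom = T := fun T => by
    ext x
    constructor
    · rintro ⟨y, hy, rfl⟩
      exact hy
    · exact fun hx => ⟨x, hx, rfl⟩
  -- `ℤ · q` is infinite for `q ≠ 0`
  have hinf : ∀ q : ℚ, q ≠ 0 →
      ((Subgroup.zpowers (Multiplicative.ofAdd q) : Subgroup (Multiplicative ℚ)) :
        Set (Multiplicative ℚ)).Infinite := fun q hq =>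
    Set.infinite_of_injective_forall_mem (f := fun n : ℕ => Multiplicative.ofAdd q ^ n)
      (fun m n hmn => by
        have hmn' : (m : ℚ) * q = n * q := by
          simpa [← ofAdd_nsmul, nsmul_eq_mul] using congrArg Multiplicative.toAdd hmn
        exact_mod_cast mul_right_cancel₀ hq hmn')
      (fun n => Subgroup.pow_mem _ (Subgroup.mem_zpowers _) n)
  -- `ℤ · 2 ⊆ ℤ · 1`
  have h21 : S₂ ≤ S₁ := by
    rw [hS₂, Subgroup.zpowers_le, hS₁, Subgroup.mem_zpowers_iff]
    exact ⟨2, by rw [← ofAdd_zsmul]; norm_num⟩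
  -- `U + ℤ = ℚ ⟺ U + 2ℤ = ℚ`
  have hsup : ∀ U : Subgroup (Multiplicative ℚ), U ⊔ S₁ = ⊤ ↔ U ⊔ S₂ = ⊤ := fun U => by
    constructor
    · intro hU
      rw [eq_top_iff]
      intro x _
      obtain ⟨u, hu, v, hv, huv⟩ := Subgroup.mem_sup.mp
        (show Multiplicative.ofAdd (x.toAdd / 2) ∈ U ⊔ S₁ from hU ▸ Subgroup.mem_top _)
      have hx : x = u ^ 2 * v ^ 2 := by
        have h2 : ((2 : ℕ) : ℚ) * (x.toAdd / 2) = x.toAdd := by push_cast; ring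
        rw [← mul_pow, huv, ← ofAdd_nsmul, nsmul_eq_mul, h2]
        rfl
      rw [hx]
      refine Subgroup.mul_mem _ (Subgroup.mem_sup_left (U.pow_mem hu 2))
        (Subgroup.mem_sup_right ?_)
      rw [hS₁] at hv
      obtain ⟨k, rfl⟩ := Subgroup.mem_zpowers_iff.mp hv
      rw [hS₂, Subgroup.mem_zpowers_iff]
      refine ⟨k, ?_⟩
      apply Multiplicative.toAdd.injective
      simp only [toAdd_zpow, toAdd_pow, toAdd_ofAdd, zsmul_eq_mul, nsmul_eq_mul]
      push_cast
      ring
    · intro hU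
      rw [eq_top_iff, ← hU]
      exact sup_le_sup_left h21 U
  -- `α = id` is numerically cuspidal
  have hnum : (mk S₁).IsNumericallyCuspidal (mk S₂) (ContinuousMulEquiv.refl _) := by
    intro U _
    rw [hmap, cuspCount_eq_card_mul_index (mk S₁) S₁ (fun _ => rfl) U,
      cuspCount_eq_card_mul_index (mk S₂) S₂ (fun _ => rfl) U,
      index_eq_index_of_iff rat_divisible (hsup U)]
  -- apply the universal closure at the all-inclusive origin
  have hΩ := h ⟨fun _ => True⟩ (mk S₁) (mk S₂) (ContinuousMulEquiv.refl _) 2 trivial trivial rfl rfl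
    (cuspidalEdgeLikeCharacterization_of_discrete (mk S₁) () S₁ (fun _ => rfl) _ hS₁.symm
      (hS₁ ▸ hinf 1 one_ne_zero))
    (cuspidalEdgeLikeCharacterization_of_discrete (mk S₂) () S₂ (fun _ => rfl) _ hS₂.symm
      (hS₂ ▸ hinf 2 two_ne_zero))
    (cyclicCuspidallyTotallyRamifiedIff_of_divisible rat_divisible (mk S₁))
    (cyclicCuspidallyTotallyRamifiedIff_of_divisible rat_divisible (mk S₂)) hnum
  -- the cuspidal subgroup `ℤ · 1` of `G` would be carried to the cuspidal subgroup `ℤ · 2` of `H`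
  obtain ⟨c, γ, hc⟩ := hΩ.1 S₁ ⟨(), 1, by rw [one_smul]⟩
  rw [hmap, hsmul] at hc
  have h1 : Multiplicative.ofAdd (1 : ℚ) ∈ S₂ := by
    have h1' : Multiplicative.ofAdd (1 : ℚ) ∈ S₁ := hS₁ ▸ Subgroup.mem_zpowers _
    rw [hc] at h1'
    exact h1'
  rw [hS₂, Subgroup.mem_zpowers_iff] at h1
  obtain ⟨k, hk⟩ := h1
  have hk' : (k : ℚ) * 2 = 1 := by
    simpa [toAdd_zpow, toAdd_ofAdd] using congrArg Multiplicative.toAdd hk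
  have hk2 : (k * 2 : ℤ) = 1 := by exact_mod_cast hk'
  omega

end Literature.IUT.HodgeTheaters.Rmk123

end
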